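import Literature.NumberTheory.Automorphic.ResiduallyRegularOrbitalIntegral   -- ★ p838784 F0P3b-p01 (g5): the `GL_n` pattern; brings ★ (s4) `OrbitalIntegralKConjugacyClasses`, ★ `OrbitalMeasureCanonical`
import Literature.NumberTheory.Automorphic.LocalUnitaryGroupCongrMeasure       -- ★ instances on `(cmDatum L N H).Local v` (loc. compact, 2nd countable, T₂); brings ★ `cmLocalIntegralLevel`
import HarnessLib

/-!
# The residually-regular base case of the unit orbital integral — GROUP-GENERIC, and the UNITARY (inert-place) instance:
`O_γ(1_K) = vol(K)` when `(G·γ) ∩ K` is a single `K`-class and `G_γ ∩ K` is the compact core; `= 1` for canonical measures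

Topic `NumberTheory/Automorphic`; namespace `Literature.NumberTheory.Automorphic`.  THEOREMS ONLY (no definition, no instance, no notation,
no named fact, no `sorry`).  Cell `hodgecm-mathlib`, F0∕P3a road letter «D-S3u» (LEAD F0P3a-plan (g8) T7-36, A-p01 (g19)): the inert-place twin of
★ p838784 `ResiduallyRegularOrbitalIntegral` (F0P3b-p01 (g5), `G = GL_n(E)`, `K = GL_n(𝒪_E)`).  HONEST LABEL: HC_CM is proved only modulo the printed
citations until rung 0 closes; this file proves NO letter — it is the orbital reading of the trivial case «`O_γ(1_K) = 1`» of the unit fundamental lemma N7 at a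
place where `K ≤ G` is ANY compact open subgroup (§1) and, in particular, `K = U(H)(𝒪_v) ≤ U(H)(L⁺_v)` (§2).

SEARCH-BEFORE-STATE (u0).  ★ p838784's proofs use nothing `GL`-specific beyond «`K` compact open»: its engine ★ (s4)
`OrbitalIntegralKConjugacyClasses.{lintegral,orbitalIntegral}_indicator_quotientMeasure_eq_of_single_conjClass` is already stated for an arbitrary locally compact,
second countable, T₂ group `G` and an arbitrary compact open `K ≤ G`; only the three heads of p838784 pin `K := glInt n E`.  So §1 LIFTS them (no restatement of a ★
head: the generic single-class shape, the compact-core normalisation, the docking to ★ `OrbitalMeasureFamily.IsCanonical`, and the `ℂ`-valued forms that the letter's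
★ `IsLocalUnitTransfer` — `GlobalTransferFactor` :274–296, `1_{K′} := (cmLocalIntegralLevel …).indicator fun _ => (1 : ℂ)` — consumes), and §2 INSTANTIATES §1 on
`(cmDatum L N H).Local v = U(H)(L⁺_v)` (★ `cmDatum_Local`, instances ★ `locallyCompactSpace_cmDatum_local` ∕ `secondCountableTopology_cmDatum_local` ∕
`t2Space_cmDatum_local`) with `K := cmLocalIntegralLevel L N H v` (compact open: ★ `isCompact_isOpen_cmLocalIntegralLevel`).

THE TWO ARITHMETIC BINDERS (kept as hypotheses, exactly as in ★ p838784; their discharge is floor 2, NOT this file):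
* `hK1 : ∀ γ′ ∈ K, IsConj γ γ′ → ∃ k ∈ K, k γ k⁻¹ = γ′` — the `G`-class of `γ` meets `K` in ONE `K`-class (for residually regular semisimple `γ`: Lang's theorem on the
  smooth connected centraliser of the reduction, [Kottwitz1986, Prop. 7.1]; [Rogawski1990, §4.3 p. 43]; [Tits1979, §3.9]);
* `hcore : G_γ ∩ K = compactCore G_γ` — `G_γ ∩ K` IS the maximal compact subgroup of the torus `G_γ` (one inclusion always, ★ `preimage_val_subset_compactCore`).
The finite-field ∕ Hensel kernel of the discharge of `hK1` at an inert place (unit-norm surjectivity for unramified étale algebras with involution ⇒ uniqueness of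
rank-one hermitian `𝒪_w[γ]`-lattices) is the companion road letter «D-S3u-N» (F0P3-p02 (g10), `FieldTheory/FiniteFields/QuadraticNormSurjective`); the `GL_n`
(split-place) analogue of `hK1` is «D-S3c» `GLnResiduallyRegularConjugacy`.
§3 (the N7-inert docking «`SO_{γ_H}(1_{K_H}) = Σ_c Δ(γ_H, c) O_c(1_{K′})` in the residually-regular case») is NOT in this file: the tree's ★ `IsLocalUnitTransfer` is the
place-agnostic `IsLocalDeltaTransfer … 1_{K_H} 1_{K′}` (★ `IsDeltaTransferRel`, `LocalTransfer` :202–205: a `∑ᶠ` over ALL `G`-classes weighted by `Δ_v`), it has no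
separately typed inert clause, and cutting the `∑ᶠ` down to the one matching class needs the support of `Δ_v` at an inert place (road B6 ∕ D-S2-inert) — so by the
LEAD's rule (T7-36: «find the inert one or say it is untyped, in which case §3 is dropped») the two instances (u1) (G-side) and (u2) stand alone here.

References: [Laumon1995] G. Laumon, *Cohomology of Drinfeld Modular Varieties* I (1996), Lemma (5.3.2) p. 136; [Rogawski1990] §4.3 p. 43, §4.9 p. 54–55;
[Kottwitz1986] R. Kottwitz, *Base change for unit elements of Hecke algebras*, Compositio Math. 60 (1986), Prop. 7.1; [PlatonovRapinchuk1994] §5.1.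
-/

set_option autoImplicit false

noncomputable section

open MeasureTheory Measure Topology Set Filter Function
open NumberField IsDedekindDomain
open Literature.MeasureTheory.Group
open scoped ENNReal NNReal MatrixGroups

namespace Literature.NumberTheory.Automorphic

/-! ## §1 Group-generic: any compact open `K ≤ G` -/

section Algebra

variable {G : Type*} [Group G] (K : Subgroup G)

/-- From the single-`K`-class binder `hK1` to the shape consumed by ★ (s4): every conjugate `g γ g⁻¹ ∈ K` is `K`-conjugate to `γ` (generic form of ★
`GLn.forall_exists_glInt_conj_eq_of_single_conjClass`). [cite: Laumon1995, Lemma (5.3.2) p. 136] -/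
theorem forall_exists_conj_eq_of_single_conjClass {γ : G}
    (hK1 : ∀ γ' ∈ K, IsConj γ γ' → ∃ k ∈ K, k * γ * k⁻¹ = γ') :
    ∀ g : G, g * γ * g⁻¹ ∈ K → ∃ k ∈ K, k * γ * k⁻¹ = g * γ * g⁻¹ :=
  fun g hg => hK1 _ hg (isConj_iff.2 ⟨g, rfl⟩)

end Algebra

section Complex

variable {G : Type*} [Group G] (γ : G) (K : Subgroup G) [MeasurableSpace (G ⧸ Subgroup.centralizer ({γ} : Set G))]

/-- **the `ℂ`-valued unit element has the `ℝ`-valued orbital integral**: `O_γ^m(1_K : G → ℂ) = ↑(O_γ^m(1_K : G → ℝ))` for every measure `m` on `G ⧸ G_γ`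
(the letter's ★ `IsLocalUnitTransfer` integrates `K.indicator fun _ => (1 : ℂ)`; ★ (s4) and ★ p838784 compute the `ℝ`-valued one). [cite: Rogawski1990, §4.9 p. 54] -/
theorem orbitalIntegral_indicator_complex_eq_ofReal (m : Measure (G ⧸ Subgroup.centralizer ({γ} : Set G))) :
    orbitalIntegral γ ((K : Set G).indicator fun _ => (1 : ℂ)) m =
      ((orbitalIntegral γ ((K : Set G).indicator (1 : G → ℝ)) m : ℝ) : ℂ) := by
  rw [orbitalIntegral_eq_integral_descConj, orbitalIntegral_eq_integral_descConj, ← integral_complex_ofReal]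
  refine integral_congr_ae (Eventually.of_forall fun x => ?_)
  induction x using QuotientGroup.induction_on with
  | H g =>
    show _ = ((descConj γ (Subgroup.centralizer ({γ} : Set G)) _ ((K : Set G).indicator (1 : G → ℝ)) (g : G ⧸ _) : ℝ) : ℂ)
    rw [descConj_mk, descConj_mk]
    by_cases hg : g * γ * g⁻¹ ∈ (K : Set G)
    · rw [Set.indicator_of_mem hg, Set.indicator_of_mem hg, Pi.one_apply, Complex.ofReal_one]
    · rw [Set.indicator_of_notMem hg, Set.indicator_of_notMem hg, Complex.ofReal_zero]

end Complex

section Orbital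

variable {G : Type*} [Group G] [TopologicalSpace G] [IsTopologicalGroup G] [LocallyCompactSpace G]
  [SecondCountableTopology G] [T2Space G] [MeasurableSpace G] [BorelSpace G]
  (γ : G) (K : Subgroup G)
  [MeasurableSpace (G ⧸ Subgroup.centralizer ({γ} : Set G))]
  [BorelSpace (G ⧸ Subgroup.centralizer ({γ} : Set G))]
  [hC : IsClosed ((Subgroup.centralizer ({γ} : Set G) : Subgroup G) : Set G)]
  (t : Measure ↥(Subgroup.centralizer ({γ} : Set G))) [t.IsMulLeftInvariant]
  [IsFiniteMeasureOnCompacts t] [t.IsOpenPosMeasure] [t.IsInvInvariant] [SFinite t]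
  (ν : Measure G) [IsHaarMeasure ν] [ν.IsMulRightInvariant]

/-- **(u1, generic; compact-core normalisation) `O_γ^{ν/t}(1_K) = ν(K).toReal`** for ANY compact open `K ≤ G`, `γ ∈ K` with a single `K`-class in `(G·γ) ∩ K`
(`hK1`), `G_γ ∩ K = compactCore G_γ` (`hcore`) and `t` normalised on the compact core, `t(compactCore G_γ) = 1` (★ `OrbitalMeasureFamily.IsCanonical`'s convention) —
★ (s4) `orbitalIntegral_indicator_quotientMeasure_eq_of_single_conjClass` with `t(G_γ ∩ K) = 1`; generic form of ★ `GLn.orbitalIntegral_indicator_glInt_eq_of_single_conjClass_of_compactCore`.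
[cite: Laumon1995, Lemma (5.3.2) p. 136] [cite: Rogawski1990, §4.3 p. 43] -/
theorem orbitalIntegral_indicator_eq_of_single_conjClass_of_compactCore (hKo : IsOpen (K : Set G)) (hKc : IsCompact (K : Set G))
    (hγ : γ ∈ K) (hK1 : ∀ γ' ∈ K, IsConj γ γ' → ∃ k ∈ K, k * γ * k⁻¹ = γ')
    (hcore : {c : ↥(Subgroup.centralizer ({γ} : Set G)) | (c : G) ∈ K} = compactCore ↥(Subgroup.centralizer ({γ} : Set G)))
    (ht : t (compactCore ↥(Subgroup.centralizer ({γ} : Set G))) = 1) :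
    orbitalIntegral γ ((K : Set G).indicator (1 : G → ℝ)) (quotientMeasure (Subgroup.centralizer ({γ} : Set G)) t hC ν) = (ν K).toReal := by
  rw [orbitalIntegral_indicator_quotientMeasure_eq_of_single_conjClass γ K t ν hKo hKc hγ (forall_exists_conj_eq_of_single_conjClass K hK1),
    hcore, ht, div_one]

end Orbital

section Canonical

variable {G : Type*} [Group G] [TopologicalSpace G] [IsTopologicalGroup G] [LocallyCompactSpace G]
  [SecondCountableTopology G] [T2Space G] [MeasurableSpace G] [BorelSpace G]
  (K : Subgroup G)
  [∀ γ : G, MeasurableSpace (G ⧸ Subgroup.centralizer ({γ} : Set G))]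
  [∀ γ : G, BorelSpace (G ⧸ Subgroup.centralizer ({γ} : Set G))]
  (ν : Measure G) [IsHaarMeasure ν] [ν.IsMulRightInvariant]

/-- **(u1, generic) THE UNIT ELEMENT AGAINST A CANONICAL ORBITAL MEASURE FAMILY**: if `m` is canonical for `(P, ν)` (★ `OrbitalMeasureFamily.IsCanonical`) then at every
`P`-class `c` whose representative `γ_c` lies in the compact open `K`, has a single `K`-class in `(G·γ_c) ∩ K` (`hK1`) and `G_{γ_c} ∩ K = compactCore G_{γ_c}` (`hcore`):
`classOrbitalIntegral m 1_K c = ν(K).toReal` — generic form of ★ `GLn.classOrbitalIntegral_indicator_glInt_eq_of_isCanonical` (Kottwitz; Laumon (1996) Lemma (5.3.2);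
Rogawski §4.9). [cite: Laumon1995, Lemma (5.3.2) p. 136] [cite: Rogawski1990, §4.3 p. 43] -/
theorem classOrbitalIntegral_indicator_eq_of_single_conjClass_of_isCanonical (hKo : IsOpen (K : Set G)) (hKc : IsCompact (K : Set G))
    {P : G → Prop} {m : OrbitalMeasureFamily G} (hm : m.IsCanonical P ν) (c : ConjClasses G)
    (hPc : P (Quotient.out c)) (hγ : (Quotient.out c : G) ∈ K)
    (hK1 : ∀ γ' ∈ K, IsConj (Quotient.out c : G) γ' → ∃ k ∈ K, k * (Quotient.out c : G) * k⁻¹ = γ')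
    (hcore : {z : ↥(Subgroup.centralizer ({(Quotient.out c : G)} : Set G)) | (z : G) ∈ K} =
      compactCore ↥(Subgroup.centralizer ({(Quotient.out c : G)} : Set G))) :
    classOrbitalIntegral m ((K : Set G).indicator (1 : G → ℝ)) c = (ν K).toReal := by
  obtain ⟨t, ht, hti, htc, hmc⟩ := hm c hPc
  haveI : IsClosed ((Subgroup.centralizer ({(Quotient.out c : G)} : Set G) : Subgroup G) : Set G) := isClosed_coe_centralizer_singleton _
  haveI : BorelSpace ↥(Subgroup.centralizer ({(Quotient.out c : G)} : Set G)) := Subtype.borelSpace _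
  haveI : SecondCountableTopology ↥(Subgroup.centralizer ({(Quotient.out c : G)} : Set G)) :=
    TopologicalSpace.Subtype.secondCountableTopology _
  rw [classOrbitalIntegral_eq, hmc]
  exact orbitalIntegral_indicator_eq_of_single_conjClass_of_compactCore _ K t ν hKo hKc hγ hK1 hcore htc

/-- **`classOrbitalIntegral m 1_K c = 1`** for a canonical family at `vol(K) = 1` (same hypotheses). [cite: Laumon1995, Lemma (5.3.2) p. 136] [cite: Rogawski1990, §4.3 p. 43] -/
theorem classOrbitalIntegral_indicator_eq_one_of_single_conjClass_of_isCanonical (hKo : IsOpen (K : Set G)) (hKc : IsCompact (K : Set G))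
    {P : G → Prop} {m : OrbitalMeasureFamily G} (hm : m.IsCanonical P ν) (c : ConjClasses G)
    (hPc : P (Quotient.out c)) (hγ : (Quotient.out c : G) ∈ K)
    (hK1 : ∀ γ' ∈ K, IsConj (Quotient.out c : G) γ' → ∃ k ∈ K, k * (Quotient.out c : G) * k⁻¹ = γ')
    (hcore : {z : ↥(Subgroup.centralizer ({(Quotient.out c : G)} : Set G)) | (z : G) ∈ K} =
      compactCore ↥(Subgroup.centralizer ({(Quotient.out c : G)} : Set G)))
    (hν : ν K = 1) :
    classOrbitalIntegral m ((K : Set G).indicator (1 : G → ℝ)) c = 1 := by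
  rw [classOrbitalIntegral_indicator_eq_of_single_conjClass_of_isCanonical K ν hKo hKc hm c hPc hγ hK1 hcore, hν, ENNReal.toReal_one]

/-- **the `ℂ`-valued form the letter consumes**: `classOrbitalIntegral m (1_K : G → ℂ) c = 1` for a canonical family at `vol(K) = 1` (same hypotheses; ★
`IsLocalUnitTransfer`'s test function is `K.indicator fun _ => (1 : ℂ)`). [cite: Rogawski1990, §4.9 Prop. 4.9.1 (b) p. 55] [cite: Laumon1995, Lemma (5.3.2) p. 136] -/
theorem classOrbitalIntegral_indicator_complex_eq_one_of_single_conjClass_of_isCanonical (hKo : IsOpen (K : Set G)) (hKc : IsCompact (K : Set G))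
    {P : G → Prop} {m : OrbitalMeasureFamily G} (hm : m.IsCanonical P ν) (c : ConjClasses G)
    (hPc : P (Quotient.out c)) (hγ : (Quotient.out c : G) ∈ K)
    (hK1 : ∀ γ' ∈ K, IsConj (Quotient.out c : G) γ' → ∃ k ∈ K, k * (Quotient.out c : G) * k⁻¹ = γ')
    (hcore : {z : ↥(Subgroup.centralizer ({(Quotient.out c : G)} : Set G)) | (z : G) ∈ K} =
      compactCore ↥(Subgroup.centralizer ({(Quotient.out c : G)} : Set G)))
    (hν : ν K = 1) :
    classOrbitalIntegral m ((K : Set G).indicator fun _ => (1 : ℂ)) c = 1 := by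
  rw [classOrbitalIntegral_eq, orbitalIntegral_indicator_complex_eq_ofReal, ← classOrbitalIntegral_eq,
    classOrbitalIntegral_indicator_eq_one_of_single_conjClass_of_isCanonical K ν hKo hKc hm c hPc hγ hK1 hcore hν, Complex.ofReal_one]

end Canonical

/-! ## §2 The unitary instance: `G = U(H)(L⁺_v) = (cmDatum L N H).Local v`, `K = U(H)(𝒪_v) = cmLocalIntegralLevel L N H v` -/

namespace UnitaryGroup

variable (L : Type) [Field L] [NumberField L] [IsCMField L] (N : ℕ) (H : Matrix (Fin N) (Fin N) L)
  (v : HeightOneSpectrum (𝓞 ↥(maximalRealSubfield L)))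
  [MeasurableSpace ((cmDatum L N H).Local v)] [BorelSpace ((cmDatum L N H).Local v)]
  [∀ γ : (cmDatum L N H).Local v, MeasurableSpace ((cmDatum L N H).Local v ⧸ Subgroup.centralizer ({γ} : Set ((cmDatum L N H).Local v)))]
  [∀ γ : (cmDatum L N H).Local v, BorelSpace ((cmDatum L N H).Local v ⧸ Subgroup.centralizer ({γ} : Set ((cmDatum L N H).Local v)))]
  (ν : Measure ((cmDatum L N H).Local v)) [IsHaarMeasure ν] [ν.IsMulRightInvariant]

/-- **(u1-U) THE UNIT ELEMENT OF `U(H)(L⁺_v)` AGAINST A CANONICAL FAMILY**: for `m` canonical for `(P, ν)` on `U(H)(L⁺_v)` and a `P`-class `c` with representative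
`γ_c ∈ K_v := U(H)(𝒪_v)` (★ `cmLocalIntegralLevel`, compact open ★ `isCompact_isOpen_cmLocalIntegralLevel`), single `K_v`-class in `(G·γ_c) ∩ K_v` (`hK1`) and
`G_{γ_c} ∩ K_v = compactCore G_{γ_c}` (`hcore`): `classOrbitalIntegral m 1_{K_v} c = ν(K_v).toReal`.  At an INERT `v` this is the trivial case of the unit fundamental
lemma N7 on the `G`-side; `hK1`∕`hcore` hold for residually regular semisimple `γ_c` ([Kottwitz1986, Prop. 7.1]; floor 2, not here).
[cite: Rogawski1990, §4.3 p. 43; §4.9 Prop. 4.9.1 (b) p. 55] [cite: Laumon1995, Lemma (5.3.2) p. 136] -/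
theorem classOrbitalIntegral_indicator_cmLocalIntegralLevel_eq_of_isCanonical
    {P : (cmDatum L N H).Local v → Prop} {m : OrbitalMeasureFamily ((cmDatum L N H).Local v)} (hm : m.IsCanonical P ν)
    (c : ConjClasses ((cmDatum L N H).Local v)) (hPc : P (Quotient.out c))
    (hγ : (Quotient.out c : (cmDatum L N H).Local v) ∈ cmLocalIntegralLevel L N H v)
    (hK1 : ∀ γ' ∈ cmLocalIntegralLevel L N H v, IsConj (Quotient.out c : (cmDatum L N H).Local v) γ' →
      ∃ k ∈ cmLocalIntegralLevel L N H v, k * (Quotient.out c : (cmDatum L N H).Local v) * k⁻¹ = γ')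
    (hcore : {z : ↥(Subgroup.centralizer ({(Quotient.out c : (cmDatum L N H).Local v)} : Set ((cmDatum L N H).Local v))) |
        (z : (cmDatum L N H).Local v) ∈ cmLocalIntegralLevel L N H v} =
      compactCore ↥(Subgroup.centralizer ({(Quotient.out c : (cmDatum L N H).Local v)} : Set ((cmDatum L N H).Local v)))) :
    classOrbitalIntegral m ((cmLocalIntegralLevel L N H v : Set ((cmDatum L N H).Local v)).indicator (1 : (cmDatum L N H).Local v → ℝ)) c =
      (ν (cmLocalIntegralLevel L N H v)).toReal :=
  classOrbitalIntegral_indicator_eq_of_single_conjClass_of_isCanonical (cmLocalIntegralLevel L N H v) ν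
    (isCompact_isOpen_cmLocalIntegralLevel L N H v).2 (isCompact_isOpen_cmLocalIntegralLevel L N H v).1 hm c hPc hγ hK1 hcore

/-- **(u1-U, normalised) `classOrbitalIntegral m 1_{U(H)(𝒪_v)} c = 1`** at `vol(U(H)(𝒪_v)) = 1` (same hypotheses). [cite: Rogawski1990, §4.9 Prop. 4.9.1 (b) p. 55] -/
theorem classOrbitalIntegral_indicator_cmLocalIntegralLevel_eq_one_of_isCanonical
    {P : (cmDatum L N H).Local v → Prop} {m : OrbitalMeasureFamily ((cmDatum L N H).Local v)} (hm : m.IsCanonical P ν)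
    (c : ConjClasses ((cmDatum L N H).Local v)) (hPc : P (Quotient.out c))
    (hγ : (Quotient.out c : (cmDatum L N H).Local v) ∈ cmLocalIntegralLevel L N H v)
    (hK1 : ∀ γ' ∈ cmLocalIntegralLevel L N H v, IsConj (Quotient.out c : (cmDatum L N H).Local v) γ' →
      ∃ k ∈ cmLocalIntegralLevel L N H v, k * (Quotient.out c : (cmDatum L N H).Local v) * k⁻¹ = γ')
    (hcore : {z : ↥(Subgroup.centralizer ({(Quotient.out c : (cmDatum L N H).Local v)} : Set ((cmDatum L N H).Local v))) |
        (z : (cmDatum L N H).Local v) ∈ cmLocalIntegralLevel L N H v} =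
      compactCore ↥(Subgroup.centralizer ({(Quotient.out c : (cmDatum L N H).Local v)} : Set ((cmDatum L N H).Local v))))
    (hν : ν (cmLocalIntegralLevel L N H v) = 1) :
    classOrbitalIntegral m ((cmLocalIntegralLevel L N H v : Set ((cmDatum L N H).Local v)).indicator (1 : (cmDatum L N H).Local v → ℝ)) c = 1 :=
  classOrbitalIntegral_indicator_eq_one_of_single_conjClass_of_isCanonical (cmLocalIntegralLevel L N H v) ν
    (isCompact_isOpen_cmLocalIntegralLevel L N H v).2 (isCompact_isOpen_cmLocalIntegralLevel L N H v).1 hm c hPc hγ hK1 hcore hν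

/-- **(u1-U, the letter's currency) `classOrbitalIntegral m (1_{U(H)(𝒪_v)} : G → ℂ) c = 1`** at `vol(U(H)(𝒪_v)) = 1` — the `G`-side summand of ★ `IsLocalUnitTransfer`
(`(cmLocalIntegralLevel L 3 H′ v).indicator fun _ => (1 : ℂ)`) at a residually regular class, same hypotheses. [cite: Rogawski1990, §4.9 Prop. 4.9.1 (b) p. 55] -/
theorem classOrbitalIntegral_indicator_complex_cmLocalIntegralLevel_eq_one_of_isCanonical
    {P : (cmDatum L N H).Local v → Prop} {m : OrbitalMeasureFamily ((cmDatum L N H).Local v)} (hm : m.IsCanonical P ν)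
    (c : ConjClasses ((cmDatum L N H).Local v)) (hPc : P (Quotient.out c))
    (hγ : (Quotient.out c : (cmDatum L N H).Local v) ∈ cmLocalIntegralLevel L N H v)
    (hK1 : ∀ γ' ∈ cmLocalIntegralLevel L N H v, IsConj (Quotient.out c : (cmDatum L N H).Local v) γ' →
      ∃ k ∈ cmLocalIntegralLevel L N H v, k * (Quotient.out c : (cmDatum L N H).Local v) * k⁻¹ = γ')
    (hcore : {z : ↥(Subgroup.centralizer ({(Quotient.out c : (cmDatum L N H).Local v)} : Set ((cmDatum L N H).Local v))) |
        (z : (cmDatum L N H).Local v) ∈ cmLocalIntegralLevel L N H v} =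
      compactCore ↥(Subgroup.centralizer ({(Quotient.out c : (cmDatum L N H).Local v)} : Set ((cmDatum L N H).Local v))))
    (hν : ν (cmLocalIntegralLevel L N H v) = 1) :
    classOrbitalIntegral m ((cmLocalIntegralLevel L N H v : Set ((cmDatum L N H).Local v)).indicator fun _ => (1 : ℂ)) c = 1 :=
  classOrbitalIntegral_indicator_complex_eq_one_of_single_conjClass_of_isCanonical (cmLocalIntegralLevel L N H v) ν
    (isCompact_isOpen_cmLocalIntegralLevel L N H v).2 (isCompact_isOpen_cmLocalIntegralLevel L N H v).1 hm c hPc hγ hK1 hcore hν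

end UnitaryGroup

/-! ## §2′ (ED. 2) The endoscopic-side instance: the PAIR group `U(H₂)(L⁺_v) × U(H₁)(L⁺_v)`, `K_H = U(H₂)(𝒪_v) ×ˢ U(H₁)(𝒪_v)` -/

namespace UnitaryGroup

variable (L : Type) [Field L] [NumberField L] [IsCMField L] (N₂ N₁ : ℕ) (H₂ : Matrix (Fin N₂) (Fin N₂) L) (H₁ : Matrix (Fin N₁) (Fin N₁) L)
  (v : HeightOneSpectrum (𝓞 ↥(maximalRealSubfield L)))

/-- `K_H := U(H₂)(𝒪_v) ×ˢ U(H₁)(𝒪_v)` is compact and open in the pair group (★ `isCompact_isOpen_cmLocalIntegralLevel` twice). [cite: PlatonovRapinchuk1994, §5.1] -/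
theorem isCompact_isOpen_cmLocalIntegralLevel_prod :
    IsCompact (((cmLocalIntegralLevel L N₂ H₂ v).prod (cmLocalIntegralLevel L N₁ H₁ v) :
        Subgroup ((cmDatum L N₂ H₂).Local v × (cmDatum L N₁ H₁).Local v)) : Set ((cmDatum L N₂ H₂).Local v × (cmDatum L N₁ H₁).Local v)) ∧
      IsOpen (((cmLocalIntegralLevel L N₂ H₂ v).prod (cmLocalIntegralLevel L N₁ H₁ v) :
        Subgroup ((cmDatum L N₂ H₂).Local v × (cmDatum L N₁ H₁).Local v)) : Set ((cmDatum L N₂ H₂).Local v × (cmDatum L N₁ H₁).Local v)) := by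
  rw [Subgroup.coe_prod]
  exact ⟨(isCompact_isOpen_cmLocalIntegralLevel L N₂ H₂ v).1.prod (isCompact_isOpen_cmLocalIntegralLevel L N₁ H₁ v).1,
    (isCompact_isOpen_cmLocalIntegralLevel L N₂ H₂ v).2.prod (isCompact_isOpen_cmLocalIntegralLevel L N₁ H₁ v).2⟩

variable
  [MeasurableSpace ((cmDatum L N₂ H₂).Local v × (cmDatum L N₁ H₁).Local v)] [BorelSpace ((cmDatum L N₂ H₂).Local v × (cmDatum L N₁ H₁).Local v)]
  [∀ a : (cmDatum L N₂ H₂).Local v × (cmDatum L N₁ H₁).Local v,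
    MeasurableSpace (((cmDatum L N₂ H₂).Local v × (cmDatum L N₁ H₁).Local v) ⧸
      Subgroup.centralizer ({a} : Set ((cmDatum L N₂ H₂).Local v × (cmDatum L N₁ H₁).Local v)))]
  [∀ a : (cmDatum L N₂ H₂).Local v × (cmDatum L N₁ H₁).Local v,
    BorelSpace (((cmDatum L N₂ H₂).Local v × (cmDatum L N₁ H₁).Local v) ⧸
      Subgroup.centralizer ({a} : Set ((cmDatum L N₂ H₂).Local v × (cmDatum L N₁ H₁).Local v)))]
  (νH : Measure ((cmDatum L N₂ H₂).Local v × (cmDatum L N₁ H₁).Local v)) [IsHaarMeasure νH] [νH.IsMulRightInvariant]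

/-- **(u2-H) THE UNIT ELEMENT OF THE PAIR GROUP `U(H₂)(L⁺_v) × U(H₁)(L⁺_v)` AGAINST A CANONICAL FAMILY** — the `H`-side (`H = U(2) × U(1)`, `K_H = U(Φ₂)(𝒪_v) ×ˢ
U(Φ₁)(𝒪_v)`, ★ `IsLocalUnitTransfer`'s `1_{K_H}`) of the residually-regular base case: `classOrbitalIntegral m_H 1_{K_H} c = ν_H(K_H).toReal` at every `P`-class `c` with
representative in `K_H`, single `K_H`-class (`hK1`) and `(G_H)_{γ_c} ∩ K_H = compactCore` (`hcore`) — §1 on the product group (instances automatic).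
[cite: Rogawski1990, §4.3 p. 43; §4.9 Prop. 4.9.1 (b) p. 55] [cite: Laumon1995, Lemma (5.3.2) p. 136] -/
theorem classOrbitalIntegral_indicator_cmLocalIntegralLevel_prod_eq_of_isCanonical
    {P : (cmDatum L N₂ H₂).Local v × (cmDatum L N₁ H₁).Local v → Prop}
    {m : OrbitalMeasureFamily ((cmDatum L N₂ H₂).Local v × (cmDatum L N₁ H₁).Local v)} (hm : m.IsCanonical P νH)
    (c : ConjClasses ((cmDatum L N₂ H₂).Local v × (cmDatum L N₁ H₁).Local v)) (hPc : P (Quotient.out c))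
    (hγ : (Quotient.out c : (cmDatum L N₂ H₂).Local v × (cmDatum L N₁ H₁).Local v) ∈
      (cmLocalIntegralLevel L N₂ H₂ v).prod (cmLocalIntegralLevel L N₁ H₁ v))
    (hK1 : ∀ γ' ∈ (cmLocalIntegralLevel L N₂ H₂ v).prod (cmLocalIntegralLevel L N₁ H₁ v),
      IsConj (Quotient.out c : (cmDatum L N₂ H₂).Local v × (cmDatum L N₁ H₁).Local v) γ' →
      ∃ k ∈ (cmLocalIntegralLevel L N₂ H₂ v).prod (cmLocalIntegralLevel L N₁ H₁ v),
        k * (Quotient.out c : (cmDatum L N₂ H₂).Local v × (cmDatum L N₁ H₁).Local v) * k⁻¹ = γ')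
    (hcore : {z : ↥(Subgroup.centralizer ({(Quotient.out c : (cmDatum L N₂ H₂).Local v × (cmDatum L N₁ H₁).Local v)} :
        Set ((cmDatum L N₂ H₂).Local v × (cmDatum L N₁ H₁).Local v))) |
        (z : (cmDatum L N₂ H₂).Local v × (cmDatum L N₁ H₁).Local v) ∈ (cmLocalIntegralLevel L N₂ H₂ v).prod (cmLocalIntegralLevel L N₁ H₁ v)} =
      compactCore ↥(Subgroup.centralizer ({(Quotient.out c : (cmDatum L N₂ H₂).Local v × (cmDatum L N₁ H₁).Local v)} :
        Set ((cmDatum L N₂ H₂).Local v × (cmDatum L N₁ H₁).Local v)))) :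
    classOrbitalIntegral m ((((cmLocalIntegralLevel L N₂ H₂ v).prod (cmLocalIntegralLevel L N₁ H₁ v) :
        Subgroup ((cmDatum L N₂ H₂).Local v × (cmDatum L N₁ H₁).Local v)) : Set ((cmDatum L N₂ H₂).Local v × (cmDatum L N₁ H₁).Local v)).indicator
        (1 : (cmDatum L N₂ H₂).Local v × (cmDatum L N₁ H₁).Local v → ℝ)) c =
      (νH ((cmLocalIntegralLevel L N₂ H₂ v).prod (cmLocalIntegralLevel L N₁ H₁ v))).toReal :=
  classOrbitalIntegral_indicator_eq_of_single_conjClass_of_isCanonical _ νH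
    (isCompact_isOpen_cmLocalIntegralLevel_prod L N₂ N₁ H₂ H₁ v).2 (isCompact_isOpen_cmLocalIntegralLevel_prod L N₂ N₁ H₂ H₁ v).1 hm c hPc hγ hK1 hcore

/-- **(u2-H, the letter's currency) `classOrbitalIntegral m_H (1_{K_H} : G_H → ℂ) c = 1`** at `vol(K_H) = 1` on the pair group — the `H`-side of ★ `IsLocalUnitTransfer`
(`(K₂.prod K₁ : Set _).indicator fun _ => (1 : ℂ)`) at a residually regular class, same hypotheses. [cite: Rogawski1990, §4.9 Prop. 4.9.1 (b) p. 55] -/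
theorem classOrbitalIntegral_indicator_complex_cmLocalIntegralLevel_prod_eq_one_of_isCanonical
    {P : (cmDatum L N₂ H₂).Local v × (cmDatum L N₁ H₁).Local v → Prop}
    {m : OrbitalMeasureFamily ((cmDatum L N₂ H₂).Local v × (cmDatum L N₁ H₁).Local v)} (hm : m.IsCanonical P νH)
    (c : ConjClasses ((cmDatum L N₂ H₂).Local v × (cmDatum L N₁ H₁).Local v)) (hPc : P (Quotient.out c))
    (hγ : (Quotient.out c : (cmDatum L N₂ H₂).Local v × (cmDatum L N₁ H₁).Local v) ∈
      (cmLocalIntegralLevel L N₂ H₂ v).prod (cmLocalIntegralLevel L N₁ H₁ v))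
    (hK1 : ∀ γ' ∈ (cmLocalIntegralLevel L N₂ H₂ v).prod (cmLocalIntegralLevel L N₁ H₁ v),
      IsConj (Quotient.out c : (cmDatum L N₂ H₂).Local v × (cmDatum L N₁ H₁).Local v) γ' →
      ∃ k ∈ (cmLocalIntegralLevel L N₂ H₂ v).prod (cmLocalIntegralLevel L N₁ H₁ v),
        k * (Quotient.out c : (cmDatum L N₂ H₂).Local v × (cmDatum L N₁ H₁).Local v) * k⁻¹ = γ')
    (hcore : {z : ↥(Subgroup.centralizer ({(Quotient.out c : (cmDatum L N₂ H₂).Local v × (cmDatum L N₁ H₁).Local v)} :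
        Set ((cmDatum L N₂ H₂).Local v × (cmDatum L N₁ H₁).Local v))) |
        (z : (cmDatum L N₂ H₂).Local v × (cmDatum L N₁ H₁).Local v) ∈ (cmLocalIntegralLevel L N₂ H₂ v).prod (cmLocalIntegralLevel L N₁ H₁ v)} =
      compactCore ↥(Subgroup.centralizer ({(Quotient.out c : (cmDatum L N₂ H₂).Local v × (cmDatum L N₁ H₁).Local v)} :
        Set ((cmDatum L N₂ H₂).Local v × (cmDatum L N₁ H₁).Local v))))
    (hν : νH ((cmLocalIntegralLevel L N₂ H₂ v).prod (cmLocalIntegralLevel L N₁ H₁ v)) = 1) :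
    classOrbitalIntegral m ((((cmLocalIntegralLevel L N₂ H₂ v).prod (cmLocalIntegralLevel L N₁ H₁ v) :
        Subgroup ((cmDatum L N₂ H₂).Local v × (cmDatum L N₁ H₁).Local v)) : Set ((cmDatum L N₂ H₂).Local v × (cmDatum L N₁ H₁).Local v)).indicator
        fun _ => (1 : ℂ)) c = 1 :=
  classOrbitalIntegral_indicator_complex_eq_one_of_single_conjClass_of_isCanonical _ νH
    (isCompact_isOpen_cmLocalIntegralLevel_prod L N₂ N₁ H₂ H₁ v).2 (isCompact_isOpen_cmLocalIntegralLevel_prod L N₂ N₁ H₂ H₁ v).1 hm c hPc hγ hK1 hcore hν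

end UnitaryGroup

end Literature.NumberTheory.Automorphic

end
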